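import Literature.Algebra.EuclideanLattices.RegevRoutineProg
import HarnessLib

/-!
# Regev's per-copy routine as a circuit family, III: the classical semantics of the whole program

Third file of the circuit-level construction towards `usvp_of_dihedralCoset` (layout in
`RegevRoutineLayout.lean`, programs and the body semantics in `RegevRoutineProg.lean`). Here:

* `initSt L n x w` — the zone-wise state after the initial stage on an input assignment `w`
  carrying the input `x` on `[0, L)` and the coins on the coin wires (every other wire `0`);
  **`progInit_sem`** — `clEval (progInit L n) w = toWires (initSt …)`;
* `iterSt k` — `k` bodies applied to a state; the invariant `Inv k` (clean block zones, counter
  `k`, untouched slots / garbage from `k` on); `inv_iterSt`; **`iter_sem`** — the semantics of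
  `body 0 ++ ⋯ ++ body (k−1)`;
* **`prog_sem`** — the semantics of the whole classical program:
  `clEval (prog L n) w = toWires (iterSt (rmax L) (initSt L n x w))`, and the read-off of its
  zones: the solver zone (`prog_sem_pre`, `prog_sem_slot`), the parked input, guesses and garbage.

## References

* O. Regev, *Quantum computation and lattice problems*, SIAM J. Comput. 33 (2004), proof of
  Lemma 3.12 (p. 14).
-/

noncomputable section

namespace Literature.Algebra.EuclideanLattices

namespace RegevRoutine

open _root_.Computability Literature.Computability.Complexity Literature.Computability.Cryptography
  Literature.Computability.QuantumComplexity Literature.Computability.QuantumComplexity.ZoneGadgets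
  Turing RevSim RevClean RevMux

variable (P : Params)

/-! ### The initial stage -/

/-- **Coin wires**: the coin zones (their `ix` field and the first `slotW n` wires of their `ta`
field) and the guess zone. [cite: Regev2004, Lemma 3.12 (proof, p. 14: the uniform superposition over t, ā and the grid points)] -/
def CoinWire (L n i : ℕ) : Prop :=
  (∃ k, k < rmax P L ∧ oC P L k ≤ i ∧ i < oC P L k + (kap P L + slotW n)) ∨ (oGz P L ≤ i ∧ i < oGz P L + gam P L)

/-- **Input assignments**: the input `x` on `[0, L)`, anything on the coin wires, `0` elsewhere. [folklore] -/
structure IsInput (L n : ℕ) (x : List Bool) (w : ℕ → Bool) : Prop where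
  len : x.length = L
  inp : ∀ i, i < L → w i = x.getD i false
  zero : ∀ i, L ≤ i → ¬ CoinWire P L n i → w i = false

/-- **The state after the initial stage.** [cite: Regev2004, Def. 2.1 (the modulus N = 2^{ℓ−1} written on the input wires of the solver)] -/
def initSt (L n : ℕ) (x : List Bool) (w : ℕ → Bool) : St where
  pre := fun i => decide (i = ell n - 1)
  slot := fun _ _ => false
  ix := fun _ => false
  ta := fun _ => false
  x := x
  g := fun t => w (oGz P L + t)
  zc := 0
  wwork := fun _ => false
  wres := fun _ => false
  vwork := fun _ => false
  vres := fun _ => false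
  tm := fun _ => false
  cz := fun j t => w (oC P L j + t)
  gz := fun _ _ => false
  gt := fun _ _ => false
  rest := w

variable {P}

/-- Coin wires lie at or above `cBase`, or in the guess zone. [folklore] -/
theorem coinWire_bounds {L n i : ℕ} (hn : n ≤ L) (h : CoinWire P L n i) :
    (cBase P L ≤ i ∧ i < gBase P L) ∨ (oGz P L ≤ i ∧ i < oZ P L) := by
  have hc := offsets_chain (P := P) L
  rcases h with ⟨k, hk, h1, h2⟩ | ⟨h1, h2⟩
  · left
    have hC := oC_add_cW_le (P := P) hk
    have hCb := cBase_le_oC (P := P) L k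
    have hsw : slotW n ≤ sig L := by unfold sig slotW; have := ell_mono hn; omega
    have hcw : cW P L = kap P L + sig L := rfl
    omega
  · right; omega

set_option maxHeartbeats 1600000 in
/-- **Semantics of the initial stage.** [cite: Regev2004, Def. 2.1 (the DCP input: the modulus on the input wires)] -/
theorem progInit_sem {L n : ℕ} (hn : n ≤ L) {x : List Bool} {w : ℕ → Bool} (hw : IsInput P L n x w) :
    clEval (progInit P L n) w = toWires P L n (initSt P L n x w) := by
  have hc := offsets_chain (P := P) L
  have hsl := slots_end_le_bS (P := P) hn
  have hell : 1 ≤ ell n := by unfold ell; omega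
  have hcp := copyW_pos (P := P) L
  have hsig : 0 < sig L := by unfold sig slotW; omega
  have hcw : 0 < cW P L := by unfold cW; omega
  have hbL : L ≤ bS P L := by
    have : L ≤ ell L := by unfold ell; nlinarith [Nat.zero_le L]
    unfold bS; omega
  -- zero wires
  have hz : ∀ i, L ≤ i → ¬ ((cBase P L ≤ i ∧ i < gBase P L) ∨ (oGz P L ≤ i ∧ i < oZ P L)) → w i = false :=
    fun i hi hni => hw.zero i hi fun h => hni (coinWire_bounds hn h)
  simp only [progInit, clEval_append, clEval_cons, clEval_nil]
  rw [clEval_swapZ (Or.inl (by omega)), clEval_notsZ, clEval_notsZ, ClOp.eval_not]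
  -- the value of the left-hand side off the marked wire and off the unary markers
  set w1 := swapFun 0 (oWz P L) L w with hw1
  have hw1v : ∀ j, w1 j = if j < L then w (j + oWz P L) else if oWz P L ≤ j ∧ j < oWz P L + L then w (j - oWz P L) else w j := by
    intro j; simp only [hw1, swapFun, Nat.zero_le, true_and, Nat.zero_add, Nat.sub_zero, Nat.add_zero]
  set w3 : ℕ → Bool := fun i => if oV P L ≤ i ∧ i < oV P L + L then
      !(fun i => if oU P L ≤ i ∧ i < oU P L + L then !w1 i else w1 i) i
    else (fun i => if oU P L ≤ i ∧ i < oU P L + L then !w1 i else w1 i) i with hw3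
  have hw3v : ∀ j, ¬ (oU P L ≤ j ∧ j < oU P L + L) → ¬ (oV P L ≤ j ∧ j < oV P L + L) → w3 j = w1 j := by
    intro j h1 h2; simp only [hw3, h1, h2, if_false]
  -- zero wires of the original assignment, in the two forms met below
  have hzlow : ∀ j, j < bS P L → w1 j = false := by
    intro j hj
    rw [hw1v]
    by_cases hL : j < L
    · rw [if_pos hL]; exact hz _ (by omega) (by omega)
    · rw [if_neg hL, if_neg (by omega)]; exact hz _ (by omega) (by omega)
  funext i
  by_cases hi : i = ell n - 1
  · subst hi
    have hlt : ell n - 1 < bS P L := by have : ell n ≤ ell L := ell_mono hn; unfold bS; omega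
    rw [Function.update_self, toWires_pre _ (by omega)]
    change (!w3 (ell n - 1)) = decide (ell n - 1 = ell n - 1)
    rw [decide_eq_true rfl, hw3v _ (by omega) (by omega), hzlow _ hlt]
    rfl
  rw [Function.update_of_ne hi]
  by_cases z0 : i < ell n
  · rw [toWires_pre _ z0, hw3v _ (by omega) (by omega), hzlow _ (by omega)]
    simp [initSt, hi]
  by_cases z1 : i < ell n + rmax P L * slotW n
  · have hsw : 0 < slotW n := by unfold slotW; omega
    obtain ⟨heq, hlt⟩ := zone_eq_divMod (base := ell n) (w := slotW n) (i := i) hsw (not_lt.1 z0)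
    have hj : (i - ell n) / slotW n < rmax P L := by
      by_contra hge
      have hm : rmax P L * slotW n ≤ (i - ell n) / slotW n * slotW n := Nat.mul_le_mul_right _ (not_lt.1 hge)
      omega
    rw [toWires_slot _ hn hj hlt heq, hw3v _ (by omega) (by omega), hzlow _ (by omega)]
    rfl
  by_cases z2 : i < A0 P L
  · rw [toWires_pad _ hn (not_lt.1 z1) z2, hw3v _ (by omega) (by omega)]
    by_cases hb : i < bS P L
    · exact hzlow _ hb
    · rw [hw1v, if_neg (by omega), if_neg (by omega)]
      exact hz _ (by omega) (by omega)
  by_cases z3 : i < oIx P L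
  · rw [toWires_U _ hn (not_lt.1 z2) z3]
    simp only [hw3]
    rw [if_neg (by omega)]
    by_cases hu : i < oU P L + L
    · rw [if_pos ⟨by omega, hu⟩, hw1v, if_neg (by omega), if_neg (by omega), hz _ (by omega) (by omega)]
      simp [hu]
    · rw [if_neg (by omega), hw1v, if_neg (by omega), if_neg (by omega), hz _ (by omega) (by omega)]
      simp [hu]
  by_cases z4 : i < oV P L
  · rw [toWires_ix _ hn (not_lt.1 z3) z4, hw3v _ (by omega) (by omega), hw1v, if_neg (by omega), if_neg (by omega)]
    exact hz _ (by omega) (by omega)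
  by_cases z5 : i < oTa P L
  · rw [toWires_U2 _ hn (not_lt.1 z4) z5]
    simp only [hw3]
    by_cases hu : i < oV P L + L
    · rw [if_pos ⟨by omega, hu⟩, if_neg (by omega), hw1v, if_neg (by omega), if_neg (by omega), hz _ (by omega) (by omega)]
      simp [hu]
    · rw [if_neg (by omega), if_neg (by omega), hw1v, if_neg (by omega), if_neg (by omega), hz _ (by omega) (by omega)]
      simp [hu]
  by_cases z6 : i < oWz P L
  · rw [toWires_ta _ hn (not_lt.1 z5) z6, hw3v _ (by omega) (by omega), hw1v, if_neg (by omega), if_neg (by omega)]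
    exact hz _ (by omega) (by omega)
  by_cases z7 : i < oGz P L
  · rw [toWires_wz _ hn (not_lt.1 z6) z7, hw3v _ (by omega) (by omega), hw1v, if_neg (by omega), if_pos ⟨by omega, by omega⟩,
      hw.inp _ (by omega)]
    rfl
  by_cases z8 : i < oZ P L
  · rw [toWires_gz0 _ hn (not_lt.1 z7) z8, hw3v _ (by omega) (by omega), hw1v, if_neg (by omega), if_neg (by omega)]
    simp only [initSt]
    congr 1; omega
  by_cases z9 : i < A0 P L + n0W P L
  · rw [toWires_Z _ hn (not_lt.1 z8) z9, hw3v _ (by omega) (by omega), hw1v, if_neg (by omega), if_neg (by omega),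
      hz _ (by omega) (by omega)]
    simp [initSt]
  by_cases z10 : i < A0 P L + NNW P L
  · rw [toWires_wwork _ hn (not_lt.1 z9) z10, hw3v _ (by omega) (by omega), hw1v, if_neg (by omega), if_neg (by omega)]
    exact hz _ (by omega) (by omega)
  by_cases z11 : i < A0 P L + widthW P L
  · rw [toWires_wres _ hn (not_lt.1 z10) z11, hw3v _ (by omega) (by omega), hw1v, if_neg (by omega), if_neg (by omega)]
    exact hz _ (by omega) (by omega)
  by_cases z12 : i < oV P L + NNV P L
  · rw [toWires_vwork _ hn (not_lt.1 z11) z12, hw3v _ (by omega) (by omega), hw1v, if_neg (by omega), if_neg (by omega)]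
    exact hz _ (by omega) (by omega)
  by_cases z13 : i < oT P L
  · rw [toWires_vres _ hn (not_lt.1 z12) z13, hw3v _ (by omega) (by omega), hw1v, if_neg (by omega), if_neg (by omega)]
    exact hz _ (by omega) (by omega)
  by_cases z14 : i < cBase P L
  · rw [toWires_tm _ hn (not_lt.1 z13) z14, hw3v _ (by omega) (by omega), hw1v, if_neg (by omega), if_neg (by omega)]
    exact hz _ (by omega) (by omega)
  by_cases z15 : i < gBase P L
  · obtain ⟨heq, hlt⟩ := zone_eq_divMod (base := cBase P L) (w := cW P L) (i := i) hcw (not_lt.1 z14)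
    have hj : (i - cBase P L) / cW P L < rmax P L := by
      by_contra hge
      have hm : rmax P L * cW P L ≤ (i - cBase P L) / cW P L * cW P L := Nat.mul_le_mul_right _ (not_lt.1 hge)
      omega
    rw [toWires_cz _ hn hj hlt heq, hw3v _ (by omega) (by omega), hw1v, if_neg (by omega), if_neg (by omega)]
    have hoc : oC P L ((i - cBase P L) / cW P L) = cBase P L + (i - cBase P L) / cW P L * cW P L := rfl
    simp only [initSt]
    rw [hoc]
    exact congrArg w (by omega)
  by_cases z16 : i < gtBase P L
  · obtain ⟨heq, hlt⟩ := zone_eq_divMod (base := gBase P L) (w := copyW P L) (i := i) hcp (not_lt.1 z15)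
    have hj : (i - gBase P L) / copyW P L < rmax P L := by
      by_contra hge
      have hm : rmax P L * copyW P L ≤ (i - gBase P L) / copyW P L * copyW P L := Nat.mul_le_mul_right _ (not_lt.1 hge)
      omega
    rw [toWires_gzone _ hn hj hlt heq, hw3v _ (by omega) (by omega), hw1v, if_neg (by omega), if_neg (by omega)]
    exact hz _ (by omega) (by omega)
  by_cases z17 : i < Wtot P L
  · obtain ⟨heq, hlt⟩ := zone_eq_divMod (base := gtBase P L) (w := sig L) (i := i) hsig (not_lt.1 z16)
    have hj : (i - gtBase P L) / sig L < rmax P L := by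
      by_contra hge
      have hm : rmax P L * sig L ≤ (i - gtBase P L) / sig L * sig L := Nat.mul_le_mul_right _ (not_lt.1 hge)
      omega
    rw [toWires_gt _ hn hj hlt heq, hw3v _ (by omega) (by omega), hw1v, if_neg (by omega), if_neg (by omega)]
    exact hz _ (by omega) (by omega)
  · rw [toWires_rest _ hn (not_lt.1 z17), hw3v _ (by omega) (by omega), hw1v, if_neg (by omega), if_neg (by omega)]
    rfl

/-! ### Iterating the body -/

/-- `k` bodies applied to a state: `iterSt (k+1) s = bodySt k (iterSt k s)`. [folklore] -/
def iterSt (P : Params) (L n : ℕ) : ℕ → St → St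
  | 0, s => s
  | k + 1, s => bodySt P L n k (iterSt P L n k s)

/-- The invariant of the iteration before body `k`: clean block zones and mask, counter `k`,
slots, garbage and mask garbage from `k` on still empty. [folklore] -/
structure Inv (n k : ℕ) (s : St) : Prop where
  clean : Clean s
  tm : s.tm = fun _ => false
  zc : s.zc = k
  slot : ∀ j, k ≤ j → s.slot j = fun _ => false
  gz : ∀ j, k ≤ j → s.gz j = fun _ => false
  gt : ∀ j, k ≤ j → s.gt j = fun _ => false
  ix : s.ix = s.ix := rfl

/-- The initial state satisfies the invariant at `0`. [folklore] -/
theorem inv_initSt (L n : ℕ) (x : List Bool) (w : ℕ → Bool) : Inv n 0 (initSt P L n x w) where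
  clean := ⟨rfl, rfl, rfl, rfl⟩
  tm := rfl
  zc := rfl
  slot := fun _ _ => rfl
  gz := fun _ _ => rfl
  gt := fun _ _ => rfl

/-- **The body preserves the invariant** (and advances the counter). [folklore] -/
theorem inv_bodySt {L n k : ℕ} {s : St} (h : Inv n k s) : Inv n (k + 1) (bodySt P L n k s) where
  clean :=
    { wwork := by simp only [bodySt, midSt, stCount, stMask, stGarb, stSlot, stEta, stV0, stET, stEix, stV, stW, st2, st1]; exact h.clean.wwork
      wres := by simp only [bodySt, midSt, stCount, stMask, stGarb, stSlot, stEta, stV0, stET, stEix, stV, stW, st2, st1]; exact h.gz k le_rfl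
      vwork := by simp only [bodySt, midSt, stCount, stMask, stGarb, stSlot, stEta, stV0, stET, stEix, stV, stW, st2, st1]; exact h.clean.vwork
      vres := by simp only [bodySt, midSt, stCount, stMask, stGarb, stSlot, stEta, stV0, stET, stEix, stV, stW, st2, st1] }
  tm := by simp only [bodySt, midSt, stCount, stMask, stGarb, stSlot, stEta, stV0, stET, stEix, stV, stW, st2, st1]; exact h.gt k le_rfl
  zc := by simp only [bodySt, midSt, stCount, stMask, stGarb, stSlot, stEta, stV0, stET, stEix, stV, stW, st2, st1]
  slot := fun j hj => by
    simp only [bodySt, midSt, stCount, stMask, stGarb, stSlot, stEta, stV0, stET, stEix, stV, stW, st2, st1]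
    funext t
    rw [if_neg (fun h' => absurd h'.1 (by omega))]
    exact congrFun (h.slot j (by omega)) t
  gz := fun j hj => by
    simp only [bodySt, midSt, stCount, stMask, stGarb, stSlot, stEta, stV0, stET, stEix, stV, stW, st2, st1]
    funext t
    rw [if_neg (by omega)]
    exact congrFun (h.gz j (by omega)) t
  gt := fun j hj => by
    simp only [bodySt, midSt, stCount, stMask, stGarb, stSlot, stEta, stV0, stET, stEix, stV, stW, st2, st1]
    funext t
    rw [if_neg (by omega)]
    exact congrFun (h.gt j (by omega)) t

/-- The invariant along the iteration. [folklore] -/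
theorem inv_iterSt {L n : ℕ} {s : St} (h : Inv n 0 s) : ∀ k, Inv n k (iterSt P L n k s)
  | 0 => h
  | k + 1 => inv_bodySt (inv_iterSt h k)

/-- **Semantics of `body 0 ++ ⋯ ++ body (k−1)`** on a state satisfying the invariant at `0`.
[cite: Regev2004, Lemma 3.12 (proof, p. 14: the routine is called once per register)] -/
theorem iter_sem {L n : ℕ} (hn : n ≤ L) {s : St} (h : Inv n 0 s) :
    ∀ k, k ≤ rmax P L → clEval ((List.range k).flatMap (body P L n)) (toWires P L n s) = toWires P L n (iterSt P L n k s)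
  | 0, _ => rfl
  | k + 1, hk => by
    rw [List.range_succ, List.flatMap_append, clEval_append, iter_sem hn h k (by omega), List.flatMap_singleton,
      body_sem hn (by omega) _ (inv_iterSt h k).clean (inv_iterSt h k).zc]
    rfl

/-- **Semantics of the whole classical program of the routine** on an input assignment: the
initial stage followed by `rmax` bodies. [cite: Regev2004, Lemma 3.12 (proof, p. 14)] -/
theorem prog_sem {L n : ℕ} (hn : n ≤ L) {x : List Bool} {w : ℕ → Bool} (hw : IsInput P L n x w) :
    clEval (prog P L n) w = toWires P L n (iterSt P L n (rmax P L) (initSt P L n x w)) := by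
  rw [prog, clEval_append, progInit_sem hn hw, iter_sem hn (inv_initSt L n x w) _ le_rfl]

/-! ### Reading off the final state -/

section ReadOff

variable {L n : ℕ}

/-- Fields that the body does not change. [folklore] -/
theorem bodySt_pre (k : ℕ) (s : St) : (bodySt P L n k s).pre = s.pre := by simp only [bodySt, midSt, stCount, stMask, stGarb, stSlot, stEta, stV0, stET, stEix, stV, stW, st2, st1]
/-- Fields that the body does not change. [folklore] -/
theorem bodySt_x (k : ℕ) (s : St) : (bodySt P L n k s).x = s.x := by simp only [bodySt, midSt, stCount, stMask, stGarb, stSlot, stEta, stV0, stET, stEix, stV, stW, st2, st1]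
/-- Fields that the body does not change. [folklore] -/
theorem bodySt_g (k : ℕ) (s : St) : (bodySt P L n k s).g = s.g := by simp only [bodySt, midSt, stCount, stMask, stGarb, stSlot, stEta, stV0, stET, stEix, stV, stW, st2, st1]
/-- Fields that the body does not change. [folklore] -/
theorem bodySt_rest (k : ℕ) (s : St) : (bodySt P L n k s).rest = s.rest := by simp only [bodySt, midSt, stCount, stMask, stGarb, stSlot, stEta, stV0, stET, stEix, stV, stW, st2, st1]

/-- Fields of `iterSt` that never change. [folklore] -/
theorem iterSt_const (s : St) : ∀ k,
    (iterSt P L n k s).pre = s.pre ∧ (iterSt P L n k s).x = s.x ∧ (iterSt P L n k s).g = s.g ∧ (iterSt P L n k s).rest = s.rest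
  | 0 => ⟨rfl, rfl, rfl, rfl⟩
  | k + 1 => by
    obtain ⟨h1, h2, h3, h4⟩ := iterSt_const s k
    refine ⟨?_, ?_, ?_, ?_⟩
    · rw [← h1]; exact bodySt_pre k _
    · rw [← h2]; exact bodySt_x k _
    · rw [← h3]; exact bodySt_g k _
    · rw [← h4]; exact bodySt_rest k _

/-- **The mask bit of cell `t` of register `k`**: the plain result bit `kap + t` of the second
block, read in the state in which the erase layers read it. [folklore] -/
def maskBit (P : Params) (L n k : ℕ) (s : St) (t : ℕ) : Bool :=
  eV P L n (stEix P L n (stV P L n (stW P L n (st2 P L k (st1 P L k s))))) (kap P L + t)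

/-- The `ta` zone after the compute stages: the `ta` coins of zone `k`. [folklore] -/
theorem midSt_ta (k : ℕ) (s : St) : (midSt P L n k s).ta = fun t => s.cz k (kap P L + t) := by
  simp only [midSt, stET, stEix, stV, stW, st2, st1]
  funext t
  rw [if_neg (fun h => absurd h.2 (by omega))]

/-- The mask zone after the compute stages: the old mask XOR the mask bits. [folklore] -/
theorem midSt_tm (k : ℕ) (s : St) : (midSt P L n k s).tm = fun t => s.tm t ^^ maskBit P L n k s t := by
  funext t
  simp only [midSt, stET, maskBit]
  congr 1

/-- Slots are untouched by the compute stages. [folklore] -/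
theorem midSt_slot (k : ℕ) (s : St) : (midSt P L n k s).slot = s.slot := by
  simp only [midSt, stET, stEix, stV, stW, st2, st1]

/-- **Slot `k` of the body's output**: the `ta` field of coin zone `k` XORed with the mask, on
`[0, slotW n)`; other slots unchanged (mask zone clean before the body). [cite: Regev2004, Lemma 3.12 (proof, p. 14: the register |t, ā⟩ after the measurement)] -/
theorem bodySt_slot (k : ℕ) (s : St) (htm : s.tm = fun _ => false) (j t : ℕ) :
    (bodySt P L n k s).slot j t =
      if j = k ∧ t < slotW n then (s.cz k (kap P L + t) ^^ maskBit P L n k s t) else s.slot j t := by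
  simp only [bodySt, stCount, stMask, stGarb, stSlot, stEta, stV0]
  rw [midSt_ta, midSt_tm, midSt_slot, htm]
  by_cases hj : j = k ∧ t < slotW n
  · rw [if_pos hj, if_pos hj]
    simp
  · rw [if_neg hj, if_neg hj]

/-- Later bodies do not change slot `j < k`. [folklore] -/
theorem iterSt_slot_stable {s : St} (h : Inv n 0 s) {j : ℕ} : ∀ k, j < k →
    (iterSt P L n k s).slot j = (iterSt P L n (j + 1) s).slot j
  | 0, hk => absurd hk (Nat.not_lt_zero _)
  | k + 1, hk => by
    by_cases hjk : j = k
    · subst hjk; rfl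
    · have hlt : j < k := by omega
      rw [← iterSt_slot_stable h k hlt]
      funext t
      change (bodySt P L n k (iterSt P L n k s)).slot j t = _
      rw [bodySt_slot k _ (inv_iterSt h k).tm, if_neg (fun h' => hjk h'.1)]

/-- **The slots of the final state**: slot `k < rmax` holds the `ta` coins of zone `k` XORed with
the mask of register `k`; it is read in the state before body `k`. [cite: Regev2004, Lemma 3.12 (proof, p. 14)] -/
theorem finalSt_slot {s : St} (h : Inv n 0 s) {k : ℕ} (hk : k < rmax P L) {t : ℕ} (ht : t < slotW n) :
    (iterSt P L n (rmax P L) s).slot k t =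
      ((iterSt P L n k s).cz k (kap P L + t) ^^ maskBit P L n k (iterSt P L n k s) t) := by
  rw [congrFun (iterSt_slot_stable h (rmax P L) hk) t]
  change (bodySt P L n k (iterSt P L n k s)).slot k t = _
  rw [bodySt_slot k _ (inv_iterSt h k).tm, if_pos ⟨rfl, ht⟩]

/-- **Garbage zone `k` of the body's output**: the read-out of `W` in the state after the coins
of register `k` were swapped in; other garbage zones unchanged. [folklore] -/
theorem bodySt_gz (k : ℕ) (s : St) (j : ℕ) :
    (bodySt P L n k s).gz j = if j = k then rdW P L n (st2 P L k (st1 P L k s)) else s.gz j := by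
  funext t
  simp only [bodySt, midSt, stCount, stMask, stGarb, stSlot, stEta, stV0, stET, stEix, stV, stW]
  by_cases hj : j = k
  · rw [if_pos hj, if_pos hj]
  · rw [if_neg hj, if_neg hj]
    simp only [st2, st1]

/-- **Mask garbage zone `k` of the body's output**: the old mask zone XOR the mask bits. [folklore] -/
theorem bodySt_gt (k : ℕ) (s : St) (j : ℕ) :
    (bodySt P L n k s).gt j = if j = k then (fun t => s.tm t ^^ maskBit P L n k s t) else s.gt j := by
  funext t
  simp only [bodySt, stCount, stMask, stGarb, stSlot, stEta, stV0]
  rw [midSt_tm]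
  by_cases hj : j = k
  · rw [if_pos hj, if_pos hj]
  · rw [if_neg hj, if_neg hj]
    simp only [midSt, stET, stEix, stV, stW, st2, st1]

/-- The erase bits of `ix` of register `k`: the plain result bits `0 … kap − 1` of the second block. [folklore] -/
def ixBit (P : Params) (L n k : ℕ) (s : St) (t : ℕ) : Bool := eV P L n (stV P L n (stW P L n (st2 P L k (st1 P L k s)))) t

/-- **The `ix` zone of the body's output**: the `ix` coins of zone `k` XOR the erase bits. [folklore] -/
theorem bodySt_ix (k : ℕ) (s : St) : (bodySt P L n k s).ix = fun t => s.cz k t ^^ ixBit P L n k s t := by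
  simp only [bodySt, midSt, stCount, stMask, stGarb, stSlot, stEta, stV0, stET, stEix, ixBit]
  funext t
  congr 1

/-- **The `ta` zone of the body's output**: the old slot `k` on `[0, slotW n)`, the XOR with the mask beyond. [folklore] -/
theorem bodySt_ta (k : ℕ) (s : St) :
    (bodySt P L n k s).ta = fun t => if t < slotW n then s.slot k t else (s.cz k (kap P L + t) ^^ (s.tm t ^^ maskBit P L n k s t)) := by
  simp only [bodySt, stCount, stMask, stGarb, stSlot, stEta, stV0]
  rw [midSt_ta, midSt_tm, midSt_slot]

/-- **The mask zone of the body's output**: the old mask garbage zone `k`. [folklore] -/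
theorem bodySt_tm (k : ℕ) (s : St) : (bodySt P L n k s).tm = s.gt k := by
  simp only [bodySt, midSt, stCount, stMask, stGarb, stSlot, stEta, stV0, stET, stEix, stV, stW, st2, st1]

/-- **Coin zones of the body's output**: zone `k` receives the old `ix` and `ta` zones, others unchanged. [folklore] -/
theorem bodySt_cz (k : ℕ) (s : St) (j t : ℕ) :
    (bodySt P L n k s).cz j t =
      if j = k ∧ t < kap P L then s.ix t else if j = k ∧ kap P L ≤ t ∧ t < cW P L then s.ta (t - kap P L) else s.cz j t := by
  simp only [bodySt, midSt, stCount, stMask, stGarb, stSlot, stEta, stV0, stET, stEix, stV, stW, st2, st1]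
  by_cases h1 : j = k ∧ kap P L ≤ t ∧ t < cW P L
  · rw [if_pos h1, if_neg (fun h => by omega), if_pos h1]
  · rw [if_neg h1]
    by_cases h2 : j = k ∧ t < kap P L
    · rw [if_pos h2, if_pos h2]
    · rw [if_neg h2, if_neg h2, if_neg h1]

/-- Later bodies do not change garbage zone `j < k`. [folklore] -/
theorem iterSt_gz_stable (s : St) {j : ℕ} : ∀ k, j < k → (iterSt P L n k s).gz j = (iterSt P L n (j + 1) s).gz j
  | 0, hk => absurd hk (Nat.not_lt_zero _)
  | k + 1, hk => by
    by_cases hjk : j = k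
    · subst hjk; rfl
    · have hlt : j < k := by omega
      rw [← iterSt_gz_stable s k hlt]
      change (bodySt P L n k (iterSt P L n k s)).gz j = _
      rw [bodySt_gz, if_neg hjk]

/-- Later bodies do not change mask garbage zone `j < k`. [folklore] -/
theorem iterSt_gt_stable (s : St) {j : ℕ} : ∀ k, j < k → (iterSt P L n k s).gt j = (iterSt P L n (j + 1) s).gt j
  | 0, hk => absurd hk (Nat.not_lt_zero _)
  | k + 1, hk => by
    by_cases hjk : j = k
    · subst hjk; rfl
    · have hlt : j < k := by omega
      rw [← iterSt_gt_stable s k hlt]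
      change (bodySt P L n k (iterSt P L n k s)).gt j = _
      rw [bodySt_gt, if_neg hjk]

/-- **Garbage zone `k` of the final state**: the read-out of `W` on the data of register `k`. [folklore] -/
theorem finalSt_gz {s : St} {k : ℕ} (hk : k < rmax P L) :
    (iterSt P L n (rmax P L) s).gz k = rdW P L n (st2 P L k (st1 P L k (iterSt P L n k s))) := by
  rw [iterSt_gz_stable s (rmax P L) hk]
  change (bodySt P L n k (iterSt P L n k s)).gz k = _
  rw [bodySt_gz, if_pos rfl]

/-- **Mask garbage zone `k` of the final state**: the mask bits of register `k`. [folklore] -/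
theorem finalSt_gt {s : St} (h : Inv n 0 s) {k : ℕ} (hk : k < rmax P L) :
    (iterSt P L n (rmax P L) s).gt k = fun t => maskBit P L n k (iterSt P L n k s) t := by
  rw [iterSt_gt_stable s (rmax P L) hk]
  change (bodySt P L n k (iterSt P L n k s)).gt k = _
  rw [bodySt_gt, if_pos rfl, (inv_iterSt h k).tm]
  funext t; simp

end ReadOff

end RegevRoutine

end Literature.Algebra.EuclideanLattices

end
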